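import Literature.Analysis.Pluripotential.NonPluripolarMongeAmpereMassSiuProofs
import HarnessLib

/-!
# Lelong numbers and Siu's theorem for weighted sums `Σₖ wₖ log |Fₖ|` of polynomial logarithms

Topic `Literature/Analysis/Pluripotential`; continuation of the algebraic-logarithmic-potential
sections of `NonPluripolarMongeAmpereMassSiuProofs.lean` (which has grown past the per-file size
limit of the gate). For non-zero polynomials `F₁, …, F_K` on `ℂᴺ` (`N ≥ 1`) and weights `wₖ > 0`
— the local form of the cone potentials `Σₖ (cₖ/dₖ) log |Fₖ|` of the positive combinations of
hypersurface currents `Σₖ aₖ [Fₖ = 0]` on `ℙᴺ` — we prove: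

* `add_mem_lelongSlopes`, `sum_mem_lelongSlopes`, `mul_mem_lelongSlopes` — admissible Lelong slopes
  add and scale;
* `norm_eval_ge_of_eval_homogeneousComponent_ne_zero` — lower bound `|g(w + τ y)| ≥ c₀ |τ|^k`
  along a GIVEN direction `y` on which the `k`-th homogeneous component of `g(X + w)` does not
  vanish;
* `lelongNumber_sum_const_mul_log_enorm_eval` — **additivity**:
  `ν(Σₖ wₖ log |Fₖ|, x) = Σₖ wₖ ν(log |Fₖ|, x)` (`= Σₖ wₖ ord_x Fₖ` by Hörmander, *Notions of
  Convexity*, Cor. 4.1.18), using a direction generic for all the `Fₖ` at once;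
* `isAnalyticSet_lelongUpperLevelSet_sum_const_mul_log_enorm_eval` — **Siu's theorem for these
  functions**: `{x | ν(Σ wₖ log |Fₖ|, x) ≥ c}` is an analytic subset of `ℂᴺ` (a finite union of
  intersections of vanishing-order level sets);
* `IsPlurisubharmonicOn.sup`, `isPlurisubharmonicOn_finset_sup'`, `lelongSlopes_sup`,
  `lelongSlopes_finset_sup'`, `lelongNumber_finset_sup'_log_enorm_eval`
  (`ν(maxₖ log |Fₖ|, x) = minₖ ν(log |Fₖ|, x)`) and
  `isAnalyticSet_lelongUpperLevelSet_finset_sup'_log_enorm_eval` — the same for the MAXIMA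
  `maxₖ log |Fₖ|` (local potentials of currents with algebraic analytic singularities, whose
  Lelong level sets have codimension `≥ 2` in general).

## References

* [Siu1974] Y.-T. Siu, Analyticity of sets associated to Lelong numbers and the extension of
  closed positive currents, Invent. Math. 27 (1974): Main Theorem.
* L. Hörmander, Notions of Convexity (1994), Cor. 4.1.18, Thm. 4.3.3.
* [HormanderSCV1973] L. Hörmander, An introduction to complex analysis in several variables
  (1973), Cor. 1.6.6 and §2.6.
-/

noncomputable section

open scoped Topology ENNReal Manifold ContDiff
open MeasureTheory Filter Set Metric

namespace Literature.Analysis.Pluripotential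

section WeightedSums

open MvPolynomial

variable {N : ℕ}

/-- Coercion `ℝ → [-∞, +∞]` commutes with finite sums. [folklore] -/
theorem EReal.coe_finsetSum {ι : Type*} (s : Finset ι) (f : ι → ℝ) :
    ((∑ i ∈ s, f i : ℝ) : EReal) = ∑ i ∈ s, (f i : EReal) :=
  map_sum (⟨⟨Real.toEReal, EReal.coe_zero⟩, EReal.coe_add⟩ : ℝ →+ EReal) f s

/-- Admissible Lelong slopes add under sums of functions. [folklore] -/
theorem add_mem_lelongSlopes {E : Type*} [NormedAddCommGroup E] {u v : E → EReal} {x : E}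
    {γ γ' : ℝ} (hγ : γ ∈ lelongSlopes u x) (hγ' : γ' ∈ lelongSlopes v x) :
    γ + γ' ∈ lelongSlopes (u + v) x := by
  obtain ⟨hγ0, C, hC⟩ := hγ
  obtain ⟨hγ'0, C', hC'⟩ := hγ'
  refine ⟨add_nonneg hγ0 hγ'0, C + C', ?_⟩
  filter_upwards [hC, hC'] with z hz hz'
  rw [Pi.add_apply]
  refine (add_le_add hz hz').trans_eq ?_
  rw [← EReal.coe_add]
  congr 1; ring

/-- Finite sums of admissible slopes are admissible for the sum of the functions. [folklore] -/
theorem sum_mem_lelongSlopes {E : Type*} [NormedAddCommGroup E] {ι : Type*} (s : Finset ι)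
    {u : ι → E → EReal} {x : E} {γ : ι → ℝ} (hx : (0 : ℝ) ∈ lelongSlopes (fun _ : E ↦ (0 : EReal)) x)
    (h : ∀ i ∈ s, γ i ∈ lelongSlopes (u i) x) :
    (∑ i ∈ s, γ i) ∈ lelongSlopes (fun z ↦ ∑ i ∈ s, u i z) x := by
  classical
  induction s using Finset.induction_on with
  | empty => simpa using hx
  | insert a s ha ih =>
    rw [Finset.sum_insert ha]
    have h1 := add_mem_lelongSlopes (h a (Finset.mem_insert_self a s))
      (ih fun i hi ↦ h i (Finset.mem_insert_of_mem hi))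
    convert h1 using 2
    funext z
    rw [Pi.add_apply, Finset.sum_insert ha]

/-- Positive multiples of admissible slopes. [folklore] -/
theorem mul_mem_lelongSlopes {E : Type*} [NormedAddCommGroup E] {u : E → EReal} {x : E}
    {γ a : ℝ} (ha : 0 ≤ a) (hγ : γ ∈ lelongSlopes u x) :
    a * γ ∈ lelongSlopes (fun z ↦ (a : EReal) * u z) x := by
  obtain ⟨hγ0, C, hC⟩ := hγ
  refine ⟨mul_nonneg ha hγ0, a * C, ?_⟩
  filter_upwards [hC] with z hz
  refine (monotone_coe_mul_left ha hz).trans_eq ?_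
  show (a : EReal) * (((γ * Real.log ‖z - x‖ + C : ℝ)) : EReal) = _
  rw [← EReal.coe_mul]
  congr 1; ring

/-- **Lower bound along a GIVEN good direction**: if the homogeneous components `H_j`, `j < k`, of
`g(X + w)` vanish and `H_k(y) ≠ 0`, then `|g(w + τ y)| ≥ c₀ |τ|^k` for small `τ`. [folklore] -/
theorem norm_eval_ge_of_eval_homogeneousComponent_ne_zero (g : MvPolynomial (Fin N) ℂ)
    (w y : Fin N → ℂ) {k : ℕ}
    (hk : ∀ j < k, homogeneousComponent j (aeval (fun i ↦ X i + C (w i)) g) = 0)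
    (hy : eval y (homogeneousComponent k (aeval (fun i ↦ X i + C (w i)) g)) ≠ 0) :
    ∃ c₀ : ℝ, 0 < c₀ ∧ ∃ δ : ℝ, 0 < δ ∧
      ∀ τ : ℂ, ‖τ‖ ≤ δ → c₀ * ‖τ‖ ^ k ≤ ‖eval (w + τ • y) g‖ := by
  set gw := aeval (fun i ↦ X i + C (w i)) g with hgw
  set T := gw.totalDegree with hT
  rcases Nat.eq_zero_or_pos k with hk0 | hkpos
  · subst hk0
    have hgw0 : eval w g ≠ 0 := by
      have hexp := eval_add_smul_eq_sum_homogeneousComponent g w y 0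
      rw [zero_smul, add_zero] at hexp
      rw [hexp, Finset.sum_eq_single_of_mem 0 (Finset.mem_range.2 (Nat.succ_pos _))
        (fun j _ hj ↦ by rw [zero_pow hj, zero_mul]), pow_zero, one_mul]
      exact hy
    have hcont : ContinuousAt (fun τ : ℂ ↦ ‖eval (w + τ • y) g‖) 0 :=
      ((MvPolynomial.continuous_eval g).comp (by fun_prop)).norm.continuousAt
    have hpos : 0 < ‖eval w g‖ / 2 := half_pos (norm_pos_iff.2 hgw0)
    have hev : ∀ᶠ τ in 𝓝 (0 : ℂ), ‖eval w g‖ / 2 < ‖eval (w + τ • y) g‖ := by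
      refine hcont.eventually (lt_mem_nhds ?_)
      simp only [zero_smul, add_zero]
      linarith [norm_pos_iff.2 hgw0]
    obtain ⟨δ, hδ, hball⟩ := Metric.eventually_nhds_iff_ball.1 hev
    refine ⟨‖eval w g‖ / 2, hpos, δ / 2, half_pos hδ, fun τ hτ ↦ ?_⟩
    rw [pow_zero, mul_one]
    exact (hball τ (mem_ball_zero_iff.2 (hτ.trans_lt (half_lt_self hδ)))).le
  · set c : ℕ → ℂ := fun j ↦ eval y (homogeneousComponent j gw) with hc
    have hck : c k ≠ 0 := hy
    have hkT : k ∈ Finset.range (T + 1) := by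
      rw [Finset.mem_range, Nat.lt_succ_iff]
      by_contra h
      push Not at h
      exact hy (by rw [homogeneousComponent_eq_zero k gw h, map_zero])
    set S : ℝ := ∑ j ∈ (Finset.range (T + 1)).erase k, ‖c j‖ with hS
    have hS0 : 0 ≤ S := Finset.sum_nonneg fun j _ ↦ norm_nonneg _
    set δ : ℝ := min 1 (‖c k‖ / (2 * S + 1)) with hδ
    have hδ0 : 0 < δ := lt_min one_pos (div_pos (norm_pos_iff.2 hck) (by linarith))
    refine ⟨‖c k‖ / 2, half_pos (norm_pos_iff.2 hck), δ, hδ0, fun τ hτ ↦ ?_⟩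
    have hτ1 : ‖τ‖ ≤ 1 := hτ.trans (min_le_left _ _)
    have hτ2 : ‖τ‖ * (2 * S + 1) ≤ ‖c k‖ := by
      have := hτ.trans (min_le_right _ _)
      rwa [le_div_iff₀ (by linarith)] at this
    have hexp := eval_add_smul_eq_sum_homogeneousComponent g w y τ
    rw [← Finset.add_sum_erase _ _ hkT] at hexp
    have htail : ‖∑ j ∈ (Finset.range (T + 1)).erase k, τ ^ j * c j‖ ≤ ‖τ‖ ^ (k + 1) * S := by
      rw [hS, Finset.mul_sum]
      refine (norm_sum_le _ _).trans (Finset.sum_le_sum fun j hj ↦ ?_)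
      rw [norm_mul, norm_pow]
      have hjk : j ≠ k := Finset.ne_of_mem_erase hj
      rcases lt_or_gt_of_ne hjk with hlt | hgt
      · have : c j = 0 := by
          show eval y (homogeneousComponent j gw) = 0
          rw [hk j hlt, map_zero]
        rw [this, norm_zero, mul_zero, mul_zero]
      · exact mul_le_mul_of_nonneg_right (pow_le_pow_of_le_one (norm_nonneg _) hτ1 hgt)
          (norm_nonneg _)
    have hmain : ‖τ‖ ^ k * ‖c k‖ - ‖τ‖ ^ (k + 1) * S ≤ ‖eval (w + τ • y) g‖ := by
      rw [hexp]
      have h1 : ‖τ ^ k * c k‖ = ‖τ‖ ^ k * ‖c k‖ := by rw [norm_mul, norm_pow]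
      have h3 : ‖τ ^ k * c k‖ - ‖∑ j ∈ (Finset.range (T + 1)).erase k, τ ^ j * c j‖ ≤
          ‖τ ^ k * c k + ∑ j ∈ (Finset.range (T + 1)).erase k, τ ^ j * c j‖ := by
        have := norm_add_le (τ ^ k * c k + ∑ j ∈ (Finset.range (T + 1)).erase k, τ ^ j * c j)
          (-(∑ j ∈ (Finset.range (T + 1)).erase k, τ ^ j * c j))
        rw [add_neg_cancel_right, norm_neg] at this
        linarith
      rw [h1] at h3
      linarith [htail]
    have hpow : ‖τ‖ ^ (k + 1) * S = ‖τ‖ ^ k * (‖τ‖ * S) := by ring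
    have hτS : ‖τ‖ * S ≤ ‖c k‖ / 2 := by
      have e : ‖τ‖ * (2 * S + 1) = 2 * (‖τ‖ * S) + ‖τ‖ := by ring
      linarith [norm_nonneg τ]
    calc ‖c k‖ / 2 * ‖τ‖ ^ k ≤ ‖τ‖ ^ k * ‖c k‖ - ‖τ‖ ^ (k + 1) * S := by
          rw [hpow]
          have h0 : 0 ≤ ‖τ‖ ^ k := by positivity
          have h1 := mul_le_mul_of_nonneg_left hτS h0
          have h2 : ‖τ‖ ^ k * ‖c k‖ = 2 * (‖τ‖ ^ k * (‖c k‖ / 2)) := by ring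
          have h3 : ‖c k‖ / 2 * ‖τ‖ ^ k = ‖τ‖ ^ k * (‖c k‖ / 2) := by ring
          linarith
      _ ≤ ‖eval (w + τ • y) g‖ := hmain

/-- **Additivity of Lelong numbers for weighted sums of `log |Fₖ|`**: for non-zero polynomials
`F₁, …, F_K` on `ℂᴺ` (`N ≥ 1`) and weights `wₖ > 0`,
`ν(Σₖ wₖ log |Fₖ|, x) = Σₖ wₖ ν(log |Fₖ|, x) = Σₖ wₖ ord_x Fₖ`
(a common direction generic for all the `Fₖ` realises every order simultaneously).
[cite: HormanderSCV1973, Cor. 1.6.6; Hörmander, Notions of Convexity, Cor. 4.1.18] -/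
theorem lelongNumber_sum_const_mul_log_enorm_eval {K : ℕ} (F : Fin K → MvPolynomial (Fin N) ℂ)
    (hF : ∀ k, F k ≠ 0) (wt : Fin K → ℝ) (hwt : ∀ k, 0 < wt k) (hN : 1 ≤ N) (x : Fin N → ℂ) :
    lelongNumber (fun z : Fin N → ℂ ↦ ∑ k, (wt k : EReal) * ENNReal.log ‖eval z (F k)‖ₑ) x =
      ∑ k, wt k * lelongNumber (fun z : Fin N → ℂ ↦ ENNReal.log ‖eval z (F k)‖ₑ) x := by
  classical
  haveI : Nonempty (Fin N) := ⟨⟨0, hN⟩⟩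
  set u : (Fin N → ℂ) → EReal := fun z ↦ ∑ k, (wt k : EReal) * ENNReal.log ‖eval z (F k)‖ₑ
    with hu
  -- the orders `n k` and good components
  choose n hνn hlow hne using fun k ↦ exists_lelongNumber_log_enorm_eval_eq (hF k) hN x
  simp_rw [hνn]
  set S : ℝ := ∑ k, wt k * (n k : ℝ) with hS
  -- zero slope for the zero function (bounded above)
  have h0 : (0 : ℝ) ∈ lelongSlopes (fun _ : Fin N → ℂ ↦ (0 : EReal)) x :=
    zero_mem_lelongSlopes (C := 0) (Eventually.of_forall fun _ ↦ by simp)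
  -- (a) `S` is an admissible slope of `u`
  have hslope : S ∈ lelongSlopes u x := by
    have hk : ∀ k ∈ (Finset.univ : Finset (Fin K)), wt k * (n k : ℝ) ∈
        lelongSlopes (fun z : Fin N → ℂ ↦ (wt k : EReal) * ENNReal.log ‖eval z (F k)‖ₑ) x := by
      intro k _
      refine mul_mem_lelongSlopes (hwt k).le ?_
      have := (isPlurisubharmonicOn_log_enorm_mvPolynomial_eval (F k)).lelongNumber_mem_lelongSlopes
        (a := x) one_pos (subset_univ _)
      rwa [hνn k] at this
    exact sum_mem_lelongSlopes Finset.univ h0 hk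
  -- (b) every admissible slope of `u` is `≤ S`
  have hupper : ∀ γ ∈ lelongSlopes u x, γ ≤ S := by
    rintro γ ⟨hγ0, Cγ, hCγ⟩
    rcases isEmpty_or_nonempty (Fin K) with hK | hK
    · -- no summands: `u ≡ 0`, only the slope `0`
      have hu0 : u = fun _ ↦ 0 := by funext z; simp [hu]
      have hS0 : S = 0 := by rw [hS]; simp
      rw [hS0]
      by_contra hlt
      push Not at hlt
      rw [eventually_nhdsWithin_iff, Metric.eventually_nhds_iff_ball] at hCγ
      obtain ⟨ε, hε, hball⟩ := hCγ
      -- a point at small distance `t` with `γ log t + Cγ < 0`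
      set t : ℝ := min (ε / 2) (Real.exp ((-Cγ - 1) / γ)) with ht
      have ht0 : 0 < t := lt_min (half_pos hε) (Real.exp_pos _)
      set y₁ : Fin N → ℂ := fun _ ↦ 1 with hy₁
      have hy₁n : ‖y₁‖ = 1 := by rw [hy₁, pi_norm_const, norm_one]
      set z : Fin N → ℂ := x + ((t : ℝ) : ℂ) • y₁ with hz
      have hnzx : ‖z - x‖ = t := by
        rw [hz, add_sub_cancel_left, norm_smul, Complex.norm_real, Real.norm_eq_abs, abs_of_pos ht0, hy₁n, mul_one]
      have hzx : z ≠ x := by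
        intro h; rw [h, sub_self, norm_zero] at hnzx; exact ht0.ne' hnzx.symm
      have := hball z (mem_ball_iff_norm.2 (by rw [hnzx]; exact (min_le_left _ _).trans_lt (half_lt_self hε))) hzx
      rw [hu0, hnzx] at this
      have hreal : (0 : ℝ) ≤ γ * Real.log t + Cγ := by
        have h' : ((0 : ℝ) : EReal) ≤ ((γ * Real.log t + Cγ : ℝ) : EReal) := this
        exact EReal.coe_le_coe_iff.1 h'
      have hlog : Real.log t ≤ (-Cγ - 1) / γ :=
        calc Real.log t ≤ Real.log (Real.exp ((-Cγ - 1) / γ)) := Real.log_le_log ht0 (min_le_right _ _)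
          _ = (-Cγ - 1) / γ := Real.log_exp _
      have := mul_le_mul_of_nonneg_left hlog hγ0
      rw [mul_div_cancel₀ _ hlt.ne'] at this
      linarith
    · -- a common good direction `y`
      obtain ⟨y, hy⟩ : ∃ y : Fin N → ℂ, ∀ k, eval y (homogeneousComponent (n k)
          (aeval (fun i ↦ X i + C (x i)) (F k))) ≠ 0 := by
        set P : MvPolynomial (Fin N) ℂ := ∏ k, homogeneousComponent (n k)
          (aeval (fun i ↦ X i + C (x i)) (F k)) with hP
        have hP0 : P ≠ 0 := Finset.prod_ne_zero_iff.2 fun k _ ↦ hne k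
        obtain ⟨y, hy⟩ : ∃ y, eval y P ≠ 0 := by
          by_contra h
          push Not at h
          exact hP0 (MvPolynomial.funext fun y ↦ by rw [h y, map_zero])
        refine ⟨y, fun k ↦ ?_⟩
        rw [hP, map_prod] at hy
        exact (Finset.prod_ne_zero_iff.1 hy) k (Finset.mem_univ k)
      -- lower bounds along `y` for each `k`
      choose c₀ hc₀ δ hδ hlowk using fun k ↦
        norm_eval_ge_of_eval_homogeneousComponent_ne_zero (F k) x y (hlow k) (hy k)
      -- `y ≠ 0` unless all orders vanish; in that case use `y₁ = (1, …, 1)` instead is not needed: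
      -- the bounds `hlowk` hold for the chosen `y` in all cases, and `y = 0` forces all `n k = 0`.
      by_contra hlt
      push Not at hlt
      rw [eventually_nhdsWithin_iff, Metric.eventually_nhds_iff_ball] at hCγ
      obtain ⟨ε, hε, hball⟩ := hCγ
      -- if `y = 0` then `S = 0 ≤ γ`... we need `S < γ` to contradict: handle `y = 0` first
      rcases eq_or_ne y 0 with hy0 | hy0
      · -- all `n k = 0` (a component of positive degree vanishes at `y = 0`), so `S = 0`
        have hn0 : ∀ k, n k = 0 := fun k ↦ by
          by_contra hk
          have := hy k
          rw [hy0, eval_zero_of_isHomogeneous (homogeneousComponent_isHomogeneous _ _)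
            (Nat.pos_of_ne_zero hk)] at this
          exact this rfl
        -- then `u` is bounded below near `x` by a real constant: contradiction with a slope `γ > S = 0`
        have hS0 : S = 0 := by rw [hS]; simp [hn0]
        rw [hS0] at hlt
        -- lower bound for `u` at the points `x + t • y₁`
        have hFx : ∀ k, eval x (F k) ≠ 0 := fun k ↦ by
          have := hlowk k 0 (by simpa using (hδ k).le)
          rw [hn0 k, pow_zero, mul_one, zero_smul, add_zero] at this
          exact fun h ↦ (not_lt.2 this) (by rw [h, norm_zero]; exact hc₀ k)
        -- continuity of `u.toReal`-like bound: use each `F k` continuous and nonzero at `x`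
        have hcont : ∀ k, ∀ᶠ z in 𝓝 x, ‖eval x (F k)‖ / 2 < ‖eval z (F k)‖ := fun k ↦ by
          have hc : ContinuousAt (fun z : Fin N → ℂ ↦ ‖eval z (F k)‖) x :=
            (MvPolynomial.continuous_eval (F k)).norm.continuousAt
          exact hc.eventually (lt_mem_nhds (by linarith [norm_pos_iff.2 (hFx k)]))
        have hall : ∀ᶠ z in 𝓝 x, ∀ k, ‖eval x (F k)‖ / 2 < ‖eval z (F k)‖ :=
          Filter.eventually_all.2 hcont
        obtain ⟨ε', hε', hball'⟩ := Metric.eventually_nhds_iff_ball.1 hall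
        set L : ℝ := ∑ k, wt k * Real.log (‖eval x (F k)‖ / 2) with hL
        set t : ℝ := min (min (ε / 2) (ε' / 2)) (Real.exp ((L - Cγ - 1) / γ)) with ht
        have ht0 : 0 < t := lt_min (lt_min (half_pos hε) (half_pos hε')) (Real.exp_pos _)
        set y₁ : Fin N → ℂ := fun _ ↦ 1 with hy₁
        have hy₁n : ‖y₁‖ = 1 := by rw [hy₁, pi_norm_const, norm_one]
        set z : Fin N → ℂ := x + ((t : ℝ) : ℂ) • y₁ with hz
        have hnzx : ‖z - x‖ = t := by
          rw [hz, add_sub_cancel_left, norm_smul, Complex.norm_real, Real.norm_eq_abs, abs_of_pos ht0,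
            hy₁n, mul_one]
        have hzx : z ≠ x := by
          intro h; rw [h, sub_self, norm_zero] at hnzx; exact ht0.ne' hnzx.symm
        have hzε : z ∈ ball x ε := mem_ball_iff_norm.2 (by
          rw [hnzx]; exact ((min_le_left _ _).trans (min_le_left _ _)).trans_lt (half_lt_self hε))
        have hzε' : z ∈ ball x ε' := mem_ball_iff_norm.2 (by
          rw [hnzx]; exact ((min_le_left _ _).trans (min_le_right _ _)).trans_lt (half_lt_self hε'))
        have hup := hball z hzε hzx
        -- lower bound `L ≤ u z`
        have hlo : ((L : ℝ) : EReal) ≤ u z := by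
          rw [hu, hL, EReal.coe_finsetSum]
          refine Finset.sum_le_sum fun k _ ↦ ?_
          have hk := hball' z hzε' k
          have hzk : eval z (F k) ≠ 0 := fun h ↦ by
            rw [h, norm_zero] at hk; linarith [norm_nonneg (eval x (F k))]
          rw [log_enorm_eq_coe hzk, ← EReal.coe_mul, EReal.coe_le_coe_iff]
          exact mul_le_mul_of_nonneg_left (Real.log_le_log (by linarith [norm_pos_iff.2 (hFx k)]) hk.le)
            (hwt k).le
        have hreal : L ≤ γ * Real.log t + Cγ := by
          have := hlo.trans hup
          rw [hnzx, EReal.coe_le_coe_iff] at this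
          exact this
        have hlog : Real.log t ≤ (L - Cγ - 1) / γ :=
          calc Real.log t ≤ Real.log (Real.exp ((L - Cγ - 1) / γ)) := Real.log_le_log ht0 (min_le_right _ _)
            _ = (L - Cγ - 1) / γ := Real.log_exp _
        have := mul_le_mul_of_nonneg_left hlog hγ0
        rw [mul_div_cancel₀ _ hlt.ne'] at this
        linarith
      · -- `y ≠ 0`: the generic-direction argument
        have hypos : 0 < ‖y‖ := norm_pos_iff.2 hy0
        haveI : Nonempty (Fin K) := hK
        set δ₀ : ℝ := Finset.univ.inf' Finset.univ_nonempty δ with hδ₀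
        have hδ₀pos : 0 < δ₀ := (Finset.lt_inf'_iff _).2 fun k _ ↦ hδ k
        have hδ₀le : ∀ k, δ₀ ≤ δ k := fun k ↦ Finset.inf'_le _ (Finset.mem_univ k)
        set L : ℝ := ∑ k, wt k * Real.log (c₀ k) with hL
        set C' : ℝ := Cγ + γ * Real.log ‖y‖ - L with hC'
        set t : ℝ := min (min δ₀ (ε / (2 * ‖y‖))) (Real.exp ((C' + 1) / (S - γ))) with ht
        have ht0 : 0 < t := lt_min (lt_min hδ₀pos (by positivity)) (Real.exp_pos _)
        have htδ : ∀ k, t ≤ δ k := fun k ↦ ((min_le_left _ _).trans (min_le_left _ _)).trans (hδ₀le k)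
        have htε : t * ‖y‖ < ε := by
          have : t ≤ ε / (2 * ‖y‖) := (min_le_left _ _).trans (min_le_right _ _)
          calc t * ‖y‖ ≤ ε / (2 * ‖y‖) * ‖y‖ := mul_le_mul_of_nonneg_right this hypos.le
            _ = ε / 2 := by field_simp
            _ < ε := half_lt_self hε
        have htlog : (S - γ) * Real.log t ≥ C' + 1 := by
          have hle : Real.log t ≤ (C' + 1) / (S - γ) :=
            calc Real.log t ≤ Real.log (Real.exp ((C' + 1) / (S - γ))) :=
                  Real.log_le_log ht0 (min_le_right _ _)
              _ = (C' + 1) / (S - γ) := Real.log_exp _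
          have hneg : S - γ < 0 := by linarith
          have := mul_le_mul_of_nonpos_left hle hneg.le
          rwa [mul_div_cancel₀ _ hneg.ne] at this
        set z : Fin N → ℂ := x + ((t : ℝ) : ℂ) • y with hz
        have hzw : z - x = ((t : ℝ) : ℂ) • y := by rw [hz, add_sub_cancel_left]
        have hnzx : ‖z - x‖ = t * ‖y‖ := by
          rw [hzw, norm_smul, Complex.norm_real, Real.norm_eq_abs, abs_of_pos ht0]
        have hzne : z ≠ x := by
          intro h
          have : ‖z - x‖ = 0 := by rw [h, sub_self, norm_zero]
          rw [hnzx] at this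
          exact (mul_pos ht0 hypos).ne' this
        have hup : u z ≤ ((γ * Real.log ‖z - x‖ + Cγ : ℝ) : EReal) :=
          hball z (mem_ball_iff_norm.2 (by rw [hnzx]; exact htε)) hzne
        -- lower bound: `u z ≥ Σ wt k (log c₀ k + n k log t) = L + S log t`
        have htk : ∀ k, c₀ k * t ^ n k ≤ ‖eval z (F k)‖ := fun k ↦ by
          have := hlowk k ((t : ℝ) : ℂ)
            (by rw [Complex.norm_real, Real.norm_eq_abs, abs_of_pos ht0]; exact htδ k)
          rwa [Complex.norm_real, Real.norm_eq_abs, abs_of_pos ht0] at this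
        have hzk : ∀ k, eval z (F k) ≠ 0 := fun k h ↦ by
          have := htk k
          rw [h, norm_zero] at this
          exact (not_lt.2 this) (by have := hc₀ k; positivity)
        have hlo : ((L + S * Real.log t : ℝ) : EReal) ≤ u z := by
          have hsum : L + S * Real.log t = ∑ k, wt k * (Real.log (c₀ k) + n k * Real.log t) := by
            rw [hL, hS, Finset.sum_mul, ← Finset.sum_add_distrib]
            refine Finset.sum_congr rfl fun k _ ↦ by ring
          rw [hsum, hu, EReal.coe_finsetSum]
          refine Finset.sum_le_sum fun k _ ↦ ?_
          rw [log_enorm_eq_coe (hzk k), ← EReal.coe_mul, EReal.coe_le_coe_iff]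
          refine mul_le_mul_of_nonneg_left ?_ (hwt k).le
          rw [← Real.log_pow, ← Real.log_mul (hc₀ k).ne' (pow_pos ht0 _).ne']
          exact Real.log_le_log (by have := hc₀ k; positivity) (htk k)
        have hreal : L + S * Real.log t ≤ γ * Real.log ‖z - x‖ + Cγ := by
          have := hlo.trans hup
          rw [EReal.coe_le_coe_iff] at this
          exact this
        rw [hnzx, Real.log_mul ht0.ne' hypos.ne'] at hreal
        have : (S - γ) * Real.log t ≤ C' := by rw [hC']; linarith
        linarith
  -- (c) conclusion
  have hbdd : BddAbove (lelongSlopes u x) := ⟨S, fun γ hγ ↦ hupper γ hγ⟩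
  rw [lelongNumber_eq_sSup]
  exact le_antisymm (csSup_le ⟨_, hslope⟩ hupper) (le_csSup hbdd hslope)

/-- **Siu's theorem for weighted sums `Σₖ wₖ log |Fₖ|` on `ℂᴺ`**: for non-zero polynomials
`F₁, …, F_K` (`N ≥ 1`), weights `wₖ > 0` and every real `c`, the Lelong upper level set
`{x | ν(Σ wₖ log |Fₖ|, x) ≥ c} = {x | Σₖ wₖ ord_x Fₖ ≥ c}` is an analytic subset of `ℂᴺ`: it is the
finite union, over the tuples `m ≤ (⌈c / wₖ⌉)ₖ` with `Σ wₖ mₖ ≥ c`, of the intersections of the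
vanishing-order level sets `{ord_x Fₖ ≥ mₖ}`.
[cite: Siu1974, Main Theorem (case of divisors); Hörmander, Notions of Convexity, Cor. 4.1.18] -/
theorem isAnalyticSet_lelongUpperLevelSet_sum_const_mul_log_enorm_eval {K : ℕ}
    (F : Fin K → MvPolynomial (Fin N) ℂ) (hF : ∀ k, F k ≠ 0) (wt : Fin K → ℝ) (hwt : ∀ k, 0 < wt k)
    (hN : 1 ≤ N) (c : ℝ) :
    Literature.Geometry.Kaehler.IsAnalyticSet 𝓘(ℂ, Fin N → ℂ)
      {x : Fin N → ℂ | c ≤ lelongNumber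
        (fun z : Fin N → ℂ ↦ ∑ k, (wt k : EReal) * ENNReal.log ‖eval z (F k)‖ₑ) x} := by
  classical
  -- the individual Lelong numbers `ν k x` are natural numbers `n k x`
  set ν : Fin K → (Fin N → ℂ) → ℝ := fun k x ↦
    lelongNumber (fun z : Fin N → ℂ ↦ ENNReal.log ‖eval z (F k)‖ₑ) x with hν
  have hnat : ∀ k x, ∃ n : ℕ, ν k x = n := fun k x ↦ by
    obtain ⟨n, hn, -, -⟩ := exists_lelongNumber_log_enorm_eval_eq (hF k) hN x
    exact ⟨n, hn⟩
  choose n hn using hnat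
  -- bounds on the useful multiplicities
  set M : Fin K → ℕ := fun k ↦ ⌈c / wt k⌉₊ with hM
  set Mset : Finset (Fin K → ℕ) := (Fintype.piFinset fun k ↦ Finset.range (M k + 1)).filter
    (fun m ↦ c ≤ ∑ k, wt k * (m k : ℝ)) with hMset
  have hset : {x : Fin N → ℂ | c ≤ lelongNumber
      (fun z : Fin N → ℂ ↦ ∑ k, (wt k : EReal) * ENNReal.log ‖eval z (F k)‖ₑ) x} =
      ⋃ m ∈ Mset, ⋂ k ∈ (Finset.univ : Finset (Fin K)),
        {x : Fin N → ℂ | (m k : ℝ) ≤ ν k x} := by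
    ext x
    simp only [mem_setOf_eq, mem_iUnion, mem_iInter, Finset.mem_univ, true_imp_iff,
      lelongNumber_sum_const_mul_log_enorm_eval F hF wt hwt hN x, exists_prop]
    constructor
    · intro hc
      by_cases hbig : ∃ k₀, (M k₀ : ℝ) ≤ ν k₀ x
      · obtain ⟨k₀, hk₀⟩ := hbig
        refine ⟨Pi.single k₀ (M k₀), ?_, fun k ↦ ?_⟩
        · rw [hMset, Finset.mem_filter, Fintype.mem_piFinset]
          refine ⟨fun k ↦ ?_, ?_⟩
          · rw [Finset.mem_range, Nat.lt_succ_iff]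
            rcases eq_or_ne k k₀ with rfl | hk
            · rw [Pi.single_eq_same]
            · rw [Pi.single_eq_of_ne hk]; exact Nat.zero_le _
          · rw [Finset.sum_eq_single_of_mem k₀ (Finset.mem_univ _) (fun k _ hk ↦ by
              rw [Pi.single_eq_of_ne hk, Nat.cast_zero, mul_zero]), Pi.single_eq_same]
            have h1 : c / wt k₀ ≤ (M k₀ : ℝ) := Nat.le_ceil _
            rw [div_le_iff₀ (hwt k₀)] at h1
            linarith
        · rcases eq_or_ne k k₀ with rfl | hk
          · rw [Pi.single_eq_same]; exact hk₀
          · rw [Pi.single_eq_of_ne hk, Nat.cast_zero]; exact lelongNumber_nonneg _ _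
      · push Not at hbig
        refine ⟨fun k ↦ n k x, ?_, fun k ↦ (hn k x).symm.le⟩
        rw [hMset, Finset.mem_filter, Fintype.mem_piFinset]
        refine ⟨fun k ↦ ?_, ?_⟩
        · rw [Finset.mem_range, Nat.lt_succ_iff]
          have := hbig k
          rw [hn k x] at this
          exact_mod_cast this.le
        · refine hc.trans_eq (Finset.sum_congr rfl fun k _ ↦ ?_)
          have hk := hn k x
          simp only [hν] at hk
          simp only [hk]
    · rintro ⟨m, hm, hmk⟩
      rw [hMset, Finset.mem_filter] at hm
      refine hm.2.trans (Finset.sum_le_sum fun k _ ↦ ?_)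
      exact mul_le_mul_of_nonneg_left (hmk k) (hwt k).le
  rw [hset]
  refine Literature.Geometry.Kaehler.isAnalyticSet_biUnion_finset _ fun m _ ↦
    Literature.Geometry.Kaehler.isAnalyticSet_biInter_finset _ fun k _ ↦ ?_
  exact isAnalyticSet_lelongUpperLevelSet_log_enorm_eval (hF k) hN _

end WeightedSums

/-! ### Maxima `maxₖ log |Fₖ|`: Lelong numbers are minima of orders, and Siu's theorem for them -/

section MaxLog

open MvPolynomial

variable {N : ℕ}

/-- **The maximum of two plurisubharmonic functions is plurisubharmonic.**
[cite: HormanderSCV1973, Thm. 1.6.2 and §2.6] -/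
theorem IsPlurisubharmonicOn.sup {E : Type*} [NormedAddCommGroup E] [NormedSpace ℂ E]
    {u v : E → EReal} {Ω : Set E} (hu : IsPlurisubharmonicOn u Ω) (hv : IsPlurisubharmonicOn v Ω) :
    IsPlurisubharmonicOn (u ⊔ v) Ω :=
  ⟨UpperSemicontinuousOn.sup hu.upperSemicontinuousOn hv.upperSemicontinuousOn,
    fun _ hz ↦ max_lt (hu.lt_top hz) (hv.lt_top hz),
    fun z w ↦ (hu.isSubharmonicOn_line z w).sup (hv.isSubharmonicOn_line z w)⟩

/-- Finite maxima of plurisubharmonic functions are plurisubharmonic. [folklore] -/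
theorem isPlurisubharmonicOn_finset_sup' {E : Type*} [NormedAddCommGroup E] [NormedSpace ℂ E]
    {ι : Type*} {s : Finset ι} (hs : s.Nonempty) {u : ι → E → EReal} {Ω : Set E}
    (h : ∀ i ∈ s, IsPlurisubharmonicOn (u i) Ω) :
    IsPlurisubharmonicOn (fun z ↦ s.sup' hs fun i ↦ u i z) Ω := by
  induction hs using Finset.Nonempty.cons_induction with
  | singleton a =>
    simp only [Finset.sup'_singleton]
    exact h a (Finset.mem_singleton_self a)
  | cons a s ha hs ih =>
    simp only [Finset.sup'_cons (H := hs)]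
    exact (h a (Finset.mem_cons_self a s)).sup (ih fun i hi ↦ h i (Finset.mem_cons_of_mem hi))

/-- The admissible Lelong slopes of a maximum are the common admissible slopes. [folklore] -/
theorem lelongSlopes_sup {E : Type*} [NormedAddCommGroup E] (u v : E → EReal) (x : E) :
    lelongSlopes (u ⊔ v) x = lelongSlopes u x ∩ lelongSlopes v x := by
  ext γ
  constructor
  · rintro ⟨hγ0, C, hC⟩
    exact ⟨⟨hγ0, C, hC.mono fun z hz ↦ (le_sup_left (a := u z) (b := v z)).trans hz⟩,
      ⟨hγ0, C, hC.mono fun z hz ↦ (le_sup_right (a := u z) (b := v z)).trans hz⟩⟩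
  · rintro ⟨⟨hγ0, C, hC⟩, ⟨-, C', hC'⟩⟩
    refine ⟨hγ0, max C C', ?_⟩
    filter_upwards [hC, hC'] with z hz hz'
    rw [Pi.sup_apply]
    refine sup_le (hz.trans ?_) (hz'.trans ?_) <;>
      exact EReal.coe_le_coe_iff.2 (by simp)

/-- The admissible Lelong slopes of a finite maximum are the common admissible slopes.
[folklore] -/
theorem lelongSlopes_finset_sup' {E : Type*} [NormedAddCommGroup E] {ι : Type*} {s : Finset ι}
    (hs : s.Nonempty) (u : ι → E → EReal) (x : E) :
    lelongSlopes (fun z ↦ s.sup' hs fun i ↦ u i z) x = ⋂ i ∈ s, lelongSlopes (u i) x := by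
  induction hs using Finset.Nonempty.cons_induction with
  | singleton a => simp [Finset.sup'_singleton]
  | cons a s ha hs ih =>
    simp only [Finset.sup'_cons (H := hs)]
    have : (fun z ↦ u a z ⊔ s.sup' hs fun i ↦ u i z) = (u a ⊔ fun z ↦ s.sup' hs fun i ↦ u i z) := rfl
    rw [this, lelongSlopes_sup, ih]
    ext γ
    simp [Finset.mem_cons]

/-- **The Lelong number of `maxₖ log |Fₖ|` is the minimum of the orders of vanishing**: for
non-zero polynomials `F₁, …, F_K` (`K ≥ 1`) on `ℂᴺ` (`N ≥ 1`),
`ν(maxₖ log |Fₖ|, x) = minₖ ν(log |Fₖ|, x) = minₖ ord_x Fₖ`.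
[cite: HormanderSCV1973, Cor. 1.6.6; Hörmander, Notions of Convexity, Cor. 4.1.18] -/
theorem lelongNumber_finset_sup'_log_enorm_eval {K : ℕ} (hK : (Finset.univ : Finset (Fin K)).Nonempty)
    (F : Fin K → MvPolynomial (Fin N) ℂ) (hF : ∀ k, F k ≠ 0) (hN : 1 ≤ N) (x : Fin N → ℂ) :
    lelongNumber (fun z : Fin N → ℂ ↦
        Finset.univ.sup' hK fun k ↦ ENNReal.log ‖eval z (F k)‖ₑ) x =
      Finset.univ.inf' hK fun k ↦
        lelongNumber (fun z : Fin N → ℂ ↦ ENNReal.log ‖eval z (F k)‖ₑ) x := by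
  haveI : Nonempty (Fin N) := ⟨⟨0, hN⟩⟩
  -- each slope set is the interval `[0, νₖ]`
  have hIcc : ∀ k, lelongSlopes (fun z : Fin N → ℂ ↦ ENNReal.log ‖eval z (F k)‖ₑ) x =
      Icc 0 (lelongNumber (fun z : Fin N → ℂ ↦ ENNReal.log ‖eval z (F k)‖ₑ) x) := fun k ↦ by
    refine (isPlurisubharmonicOn_log_enorm_mvPolynomial_eval (F k)).lelongSlopes_eq_Icc one_pos
      (subset_univ _) fun ρ hρ ↦ ?_
    obtain ⟨z, hz, hz'⟩ := ((frequently_eval_ne_zero (hF k) x).and_eventually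
      (closedBall_mem_nhds x hρ)).exists
    refine ⟨z, hz', ?_⟩
    rw [log_enorm_eq_coe hz]
    exact EReal.coe_ne_bot _
  have hset : lelongSlopes (fun z : Fin N → ℂ ↦
      Finset.univ.sup' hK fun k ↦ ENNReal.log ‖eval z (F k)‖ₑ) x =
      Icc 0 (Finset.univ.inf' hK fun k ↦
        lelongNumber (fun z : Fin N → ℂ ↦ ENNReal.log ‖eval z (F k)‖ₑ) x) := by
    rw [lelongSlopes_finset_sup']
    ext γ
    simp only [mem_iInter, Finset.mem_univ, true_imp_iff, hIcc, mem_Icc, Finset.le_inf'_iff]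
    exact ⟨fun h ↦ ⟨(h (Classical.choice (Finset.univ_nonempty_iff.1 hK))).1, fun k ↦ (h k).2⟩,
      fun h k ↦ ⟨h.1, h.2 k⟩⟩
  rw [lelongNumber_eq_sSup, hset, csSup_Icc]
  exact (Finset.le_inf'_iff _ _).2 fun k _ ↦ lelongNumber_nonneg _ _

/-- **Siu's theorem for `maxₖ log |Fₖ|` on `ℂᴺ`**: the Lelong upper level sets
`{x | ν(maxₖ log |Fₖ|, x) ≥ c} = ⋂ₖ {ord_x Fₖ ≥ c}` are analytic subsets of `ℂᴺ` — typically of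
codimension `≥ 2` (e.g. `max(log |z₁|, log |z₂|)` on `ℂ²` has the single point `0` as `E₁`).
[cite: Siu1974, Main Theorem; Hörmander, Notions of Convexity, Cor. 4.1.18] -/
theorem isAnalyticSet_lelongUpperLevelSet_finset_sup'_log_enorm_eval {K : ℕ}
    (hK : (Finset.univ : Finset (Fin K)).Nonempty) (F : Fin K → MvPolynomial (Fin N) ℂ)
    (hF : ∀ k, F k ≠ 0) (hN : 1 ≤ N) (c : ℝ) :
    Literature.Geometry.Kaehler.IsAnalyticSet 𝓘(ℂ, Fin N → ℂ)
      {x : Fin N → ℂ | c ≤ lelongNumber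
        (fun z : Fin N → ℂ ↦ Finset.univ.sup' hK fun k ↦ ENNReal.log ‖eval z (F k)‖ₑ) x} := by
  have hset : {x : Fin N → ℂ | c ≤ lelongNumber
      (fun z : Fin N → ℂ ↦ Finset.univ.sup' hK fun k ↦ ENNReal.log ‖eval z (F k)‖ₑ) x} =
      ⋂ k ∈ (Finset.univ : Finset (Fin K)),
        {x : Fin N → ℂ | c ≤ lelongNumber (fun z : Fin N → ℂ ↦ ENNReal.log ‖eval z (F k)‖ₑ) x} := by
    ext x
    simp only [mem_setOf_eq, mem_iInter, Finset.mem_univ, true_imp_iff,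
      lelongNumber_finset_sup'_log_enorm_eval hK F hF hN x, Finset.le_inf'_iff]
  rw [hset]
  exact Literature.Geometry.Kaehler.isAnalyticSet_biInter_finset _ fun k _ ↦
    isAnalyticSet_lelongUpperLevelSet_log_enorm_eval (hF k) hN c

end MaxLog

end Literature.Analysis.Pluripotential

end
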